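import Literature.NumberTheory.Automorphic.ArchEndoscopicStableClassFlips        -- ★ p849928 (LH2-p04): flips are stably conjugate (`isArchStablyConjH_out_mk_endoTorus_flipSet`), `endoCircle_flipSet`; swap `J` (★ p849838)
import Literature.NumberTheory.Automorphic.ArchEndoscopicChartExhaustion         -- ★ (EXH-H) (LH3-p03): `exists_conj_endoTorus_of_isArchGRegular`, `isArchGRegular_endoTorus_iff_mem_regG`
import Literature.NumberTheory.Automorphic.LocalEndoscopicOrbitClosed            -- ★ `isGRegular_of_isStablyConjH`
import Literature.NumberTheory.Rogawski1990.ArchBouazizStableFamily              -- ★ (D2-P3) (LH3-p01): `hypBlockGL_eq_of_circleExp_eq`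
import HarnessLib

/-!
# The stable class of a `G`-regular chart point of `H_∞` is EXACTLY its flip classes (the `hidx` of R4 (READ-H))
# (Rogawski 1990 §3.1, §3.6, §4.1, §8.2; Shelstad 1979 §4)

Topic `NumberTheory/Automorphic`; namespace `Literature.NumberTheory.Automorphic.UnitaryGroup`.  THEOREMS ONLY (no `def`, no instance, no notation, no axiom, no named
fact, no `sorry`).  Cell `pub/hodgecm-mathlib`, crux H413 (`stmt-HodgeConjecture-24833`), F0∕P3c line LH3 (closer stub `stub_N9`, DIRECT ROAD, organ `stub_N9read`);
discharges the hypothesis `hidx` of R4 ED. 1 (★ p849891 `ArchStableSideChartRead`, LH2-p04 (g3); LH3-plan (g2) deal 2026-09-02T06:30:06Z) VERBATIM: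
**`setOf_isArchStablyConjH_out_eq_image_flipSet`** — for `c ∈ RegG S`,
`{c′ : ConjClasses H_∞ | endoTorus S c ∼_st out c′} = (T ↦ ⟦endoTorus S (flipSet T c)⟧) '' 𝒫(univ ∖ S)`.
«⊇» is ★ p849928; «⊆» (this file) is the UNIQUENESS OF CHART COORDINATES UP TO FLIPS:

* §1 invariants of `GL₂(ℂ)`-conjugacy (trace, determinant ⇒ the unordered eigenvalue pair); `GL₁(ℂ)`-conjugacy is equality.
* §2 the three place comparisons: two Cayley blocks `P·diag(u,v)·P⁻¹ ∼ P·diag(u′,v′)·P⁻¹` ⇒ `{u,v} = {u′,v′}` (`eq_or_swap_of_isConj_cayley`); two hyperbolic blocks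
  `diag(e^{±x+iθ}) ∼ diag(e^{±x′+iθ′})` ⇒ `e^{iθ} = e^{iθ′}`, `x = ±x′` (`circleExp_eq_and_eq_or_eq_neg_of_isConj_hypBlockGL`); a Cayley block is NEVER conjugate to a
  hyperbolic block with `x ≠ 0` (`‖u+v‖ ≤ 2 < 2 cosh x = ‖tr‖`, `not_isConj_cayley_hypBlockGL`).
* §3 **`eq_of_isArchStablyConjH_endoTorus`**: `endoTorus S c ∼_st endoTorus S′ c′` with `c ∈ RegG S`, `c′ ∈ RegG S′` forces `S′ = S` (★ (g1) place by place + §2), and then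
  **`exists_conj_eq_endoTorus_flipSet_of_isArchStablyConjH`**: `n · endoTorus S c′ · n⁻¹ = endoTorus S (flipSet T c)` for some `T ⊆ univ ∖ S` and `n ∈ H_∞` — at `w ∉ S`
  the angles agree up to the flip `θ₀ ↔ θ₂` (this defines `T`), at `w ∈ S` the angle classes agree and `x′ = ±x`, the sign being REALISED IN `H_∞` by the swap `J ∈ U(Φ₂)_w`
  (★ p849838 `swapGL_conj_hypBlockGL`); glued over the places with ★ `archPiEquivCM` exactly as in ★ (EXH-H).
* §4 with ★ (EXH-H) `exists_conj_endoTorus_of_isArchGRegular` and ★ `isGRegular_of_isStablyConjH`: every class stably conjugate to `endoTorus S c` is a flip class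
  (`exists_flipSet_mk_eq_of_isArchStablyConjH_out`), whence `hidx`.
NOT HERE: `hbox` (the flip transport of the frame's torus measures — R3 currency).  HONEST LABEL: HC_CM is proved only modulo the 7 printed citations (2 remaining:
hLiu418 = `stmt-HodgeConjecture-24832`, h413 = `stmt-HodgeConjecture-24833`) until rung 0 closes; count-neutral.

## References
* [Rogawski1990] J. D. Rogawski, *Automorphic Representations of Unitary Groups in Three Variables*, Ann. of Math. Stud. 123 (1990), §3.1 p. 19 (stable conjugacy = same
  characteristic data), §3.6 p. 31 (the two Cartans of `U(1,1)`), §4.1 p. 39 (the classes inside a stable class: `𝔇(T/ℝ)`), §8.2 p. 122.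
* [Shelstad1979] D. Shelstad, *Characters and inner forms of a quasi-split group over ℝ*, Compositio Math. 39 (1979), §4 pp. 22–23 (the stable class of a regular element of
  `T(ℝ)` is indexed by the imaginary Weyl reflections modulo the realised ones).
* [Knapp1986] A. W. Knapp, *Representation Theory of Semisimple Groups*, Princeton (1986), Ch. V §3 (Cartan subgroups of `SU(1,1)`).
-/

set_option autoImplicit false

noncomputable section

open NumberField NumberField.InfinitePlace Matrix Complex Topology
open Literature.NumberTheory.Automorphic.ArchCartan
open scoped MatrixGroups Matrix ComplexConjugate Classical Real

namespace Literature.NumberTheory.Automorphic.UnitaryGroup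

open Literature.NumberTheory.Rogawski1990

/-! ## §1 Invariants of `GL₂(ℂ)`-conjugacy; `GL₁(ℂ)`-conjugacy is equality -/

section Invariants

/-- Conjugate elements of `GL₂(ℂ)` have the same trace. [cite: Rogawski1990, §3.1 p. 19] -/
theorem trace_coe_eq_of_isConj {A B : GL (Fin 2) ℂ} (h : IsConj A B) :
    ((A : GL (Fin 2) ℂ) : Matrix (Fin 2) (Fin 2) ℂ).trace = ((B : GL (Fin 2) ℂ) : Matrix (Fin 2) (Fin 2) ℂ).trace := by
  obtain ⟨k, hk⟩ := isConj_iff.1 h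
  rw [← hk, Units.val_mul, Units.val_mul, Matrix.trace_units_conj]

/-- Conjugate elements of `GL₂(ℂ)` have the same determinant. [cite: Rogawski1990, §3.1 p. 19] -/
theorem det_coe_eq_of_isConj {A B : GL (Fin 2) ℂ} (h : IsConj A B) :
    ((A : GL (Fin 2) ℂ) : Matrix (Fin 2) (Fin 2) ℂ).det = ((B : GL (Fin 2) ℂ) : Matrix (Fin 2) (Fin 2) ℂ).det := by
  obtain ⟨k, hk⟩ := isConj_iff.1 h
  rw [← hk, Units.val_mul, Units.val_mul, Matrix.det_units_conj]

/-- The unordered pair is determined by sum and product: `a + b = a′ + b′`, `ab = a′b′` ⇒ `{a, b} = {a′, b′}` (private: a BSD Theorems file has the same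
elementary statement). [cite: Rogawski1990, §3.1 p. 19] -/
private theorem eq_or_eq_swap_of_add_eq_of_mul_eq' {a b a' b' : ℂ} (hs : a + b = a' + b') (hp : a * b = a' * b') :
    (a = a' ∧ b = b') ∨ (a = b' ∧ b = a') := by
  have h0 : (a - a') * (a - b') = 0 := by linear_combination a * hs - hp
  rcases mul_eq_zero.1 h0 with h | h
  · have ha : a = a' := sub_eq_zero.1 h
    exact Or.inl ⟨ha, by linear_combination hs - ha⟩
  · have ha : a = b' := sub_eq_zero.1 h
    exact Or.inr ⟨ha, by linear_combination hs - ha⟩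

/-- In the commutative group `GL₁(ℂ)` conjugacy is equality. [cite: Rogawski1990, §4.9 p. 54] -/
theorem eq_of_isConj_GL_one {a b : GL (Fin 1) ℂ} (h : IsConj a b) : a = b := by
  obtain ⟨k, hk⟩ := isConj_iff.1 h
  have hcomm : k * a = a * k := by
    refine Units.ext (Matrix.ext fun i j => ?_)
    rw [Units.val_mul, Units.val_mul, Matrix.mul_apply, Matrix.mul_apply, Fin.sum_univ_one, Fin.sum_univ_one,
      Subsingleton.elim i 0, Subsingleton.elim j 0, mul_comm]
  rw [← hk, hcomm, mul_inv_cancel_right]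

/-- `e^{x+iθ} = e^{y+iθ′}` (real `x, y, θ, θ′`) iff the moduli and the angle classes agree. [cite: Rogawski1990, §3.6 p. 31] -/
theorem eq_and_circleExp_eq_of_cexp_eq {x y θ θ' : ℝ} (h : Complex.exp ((x : ℂ) + (θ : ℂ) * I) = Complex.exp ((y : ℂ) + (θ' : ℂ) * I)) :
    x = y ∧ Circle.exp θ = Circle.exp θ' := by
  have hn := congrArg (fun z : ℂ => ‖z‖) h
  simp only [Complex.norm_exp, Complex.add_re, Complex.ofReal_re, Complex.mul_re, Complex.I_re, Complex.I_im, Complex.ofReal_im, mul_zero,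
    zero_mul, sub_zero, add_zero] at hn
  have hxy : x = y := Real.exp_injective hn
  subst hxy
  rw [Complex.exp_add, Complex.exp_add] at h
  have h' := mul_left_cancel₀ (Complex.exp_ne_zero _) h
  exact ⟨rfl, Circle.ext (by rw [Circle.coe_exp, Circle.coe_exp]; exact h')⟩

end Invariants

/-! ## §2 The three place comparisons in `U(Φ₂)_w ⊂ GL₂(ℂ)` -/

section Place

/-- **Two Cayley blocks are `GL₂(ℂ)`-conjugate only if their angle pairs agree as unordered pairs.** [cite: Rogawski1990, §3.1 p. 19; §8.2 p. 122] -/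
theorem eq_or_swap_of_isConj_cayley {u v u' v' : Circle}
    (h : IsConj (Matrix.GeneralLinearGroup.mkOfDetNeZero !![(1 : ℂ), 1; 1, -1] det_cayleyTwo_ne_zero * circleDiagonal 2 ![u, v] *
        (Matrix.GeneralLinearGroup.mkOfDetNeZero !![(1 : ℂ), 1; 1, -1] det_cayleyTwo_ne_zero)⁻¹)
      (Matrix.GeneralLinearGroup.mkOfDetNeZero !![(1 : ℂ), 1; 1, -1] det_cayleyTwo_ne_zero * circleDiagonal 2 ![u', v'] *
        (Matrix.GeneralLinearGroup.mkOfDetNeZero !![(1 : ℂ), 1; 1, -1] det_cayleyTwo_ne_zero)⁻¹)) :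
    (u = u' ∧ v = v') ∨ (u = v' ∧ v = u') := by
  have ht := trace_coe_eq_of_isConj h
  have hd := det_coe_eq_of_isConj h
  rw [coe_cayley_conj_circleDiagonal, coe_cayley_conj_circleDiagonal, Matrix.trace_fin_two_of, Matrix.trace_fin_two_of] at ht
  rw [coe_cayley_conj_circleDiagonal, coe_cayley_conj_circleDiagonal, Matrix.det_fin_two_of, Matrix.det_fin_two_of] at hd
  simp only [Matrix.cons_val_zero, Matrix.cons_val_one] at ht hd
  have hs : (u : ℂ) + v = u' + v' := by linear_combination ht
  have hp : (u : ℂ) * v = u' * v' := by linear_combination hd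
  rcases eq_or_eq_swap_of_add_eq_of_mul_eq' hs hp with ⟨ha, hb⟩ | ⟨ha, hb⟩
  · exact Or.inl ⟨Circle.ext ha, Circle.ext hb⟩
  · exact Or.inr ⟨Circle.ext ha, Circle.ext hb⟩

/-- **Two hyperbolic blocks are `GL₂(ℂ)`-conjugate only if the angle classes agree and `x = ±x′`.** [cite: Rogawski1990, §3.6 p. 31] [cite: Knapp1986, Ch. V §3] -/
theorem circleExp_eq_and_eq_or_eq_neg_of_isConj_hypBlockGL {x θ x' θ' : ℝ} (h : IsConj (hypBlockGL x θ) (hypBlockGL x' θ')) :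
    Circle.exp θ = Circle.exp θ' ∧ (x = x' ∨ x = -x') := by
  have ht := trace_coe_eq_of_isConj h
  have hd := det_coe_eq_of_isConj h
  rw [coe_hypBlockGL, coe_hypBlockGL, Matrix.trace_fin_two_of, Matrix.trace_fin_two_of] at ht
  rw [coe_hypBlockGL, coe_hypBlockGL, Matrix.det_fin_two_of, Matrix.det_fin_two_of] at hd
  simp only [mul_zero, sub_zero] at hd
  rcases eq_or_eq_swap_of_add_eq_of_mul_eq' ht hd with ⟨ha, -⟩ | ⟨ha, -⟩
  · obtain ⟨hxx, hθθ⟩ := eq_and_circleExp_eq_of_cexp_eq ha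
    exact ⟨hθθ, Or.inl hxx⟩
  · rw [← Complex.ofReal_neg] at ha
    obtain ⟨hxx, hθθ⟩ := eq_and_circleExp_eq_of_cexp_eq ha
    exact ⟨hθθ, Or.inr hxx⟩

/-- **A Cayley block is never `GL₂(ℂ)`-conjugate to a hyperbolic block with `x ≠ 0`**: `‖u + v‖ ≤ 2 < 2 cosh x = ‖e^{x+iθ} + e^{−x+iθ}‖` (compact vs split Cartan of `U(1,1)`).
[cite: Rogawski1990, §3.6 p. 31] [cite: Knapp1986, Ch. V §3] -/
theorem not_isConj_cayley_hypBlockGL (u v : Circle) {x : ℝ} (θ : ℝ) (hx : x ≠ 0) :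
    ¬ IsConj (Matrix.GeneralLinearGroup.mkOfDetNeZero !![(1 : ℂ), 1; 1, -1] det_cayleyTwo_ne_zero * circleDiagonal 2 ![u, v] *
        (Matrix.GeneralLinearGroup.mkOfDetNeZero !![(1 : ℂ), 1; 1, -1] det_cayleyTwo_ne_zero)⁻¹) (hypBlockGL x θ) := by
  intro h
  have ht := trace_coe_eq_of_isConj h
  rw [coe_cayley_conj_circleDiagonal, coe_hypBlockGL, Matrix.trace_fin_two_of, Matrix.trace_fin_two_of] at ht
  simp only [Matrix.cons_val_zero, Matrix.cons_val_one] at ht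
  have hsum : (u : ℂ) + v = Complex.exp ((x : ℂ) + (θ : ℂ) * I) + Complex.exp (-(x : ℂ) + (θ : ℂ) * I) := by linear_combination ht
  have hfac : Complex.exp ((x : ℂ) + (θ : ℂ) * I) + Complex.exp (-(x : ℂ) + (θ : ℂ) * I) = ((Real.exp x + Real.exp (-x) : ℝ) : ℂ) * Complex.exp ((θ : ℂ) * I) := by
    rw [Complex.exp_add, Complex.exp_add, Complex.ofReal_add, Complex.ofReal_exp, Complex.ofReal_exp, Complex.ofReal_neg]
    ring
  have hnorm : ‖(u : ℂ) + v‖ = Real.exp x + Real.exp (-x) := by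
    rw [hsum, hfac, norm_mul, Complex.norm_real, Complex.norm_exp_ofReal_mul_I, mul_one, Real.norm_of_nonneg (by positivity)]
  have hle : ‖(u : ℂ) + v‖ ≤ 2 := by
    refine (norm_add_le _ _).trans ?_
    rw [Circle.norm_coe, Circle.norm_coe]
    norm_num
  have hcosh := Real.one_lt_cosh.2 hx
  rw [Real.cosh_eq] at hcosh
  rw [hnorm] at hle
  linarith

end Place

/-! ## §3 Uniqueness of the chart coordinates up to flips -/

section Unique

variable (L : Type) [Field L] [NumberField L] [IsCMField L]

/-- Place projection of a stable conjugacy between chart points: the `U(Φ₂)_w`-blocks are `GL₂(ℂ)`-conjugate (★ (g1)). [cite: Rogawski1990, §3.1 p. 19; §14.2 p. 232] -/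
theorem isConj_coe_endoBlock_of_isArchStablyConjH {S S' : Finset {w : InfinitePlace L // IsComplex w}} {c c' : {w : InfinitePlace L // IsComplex w} → Fin 3 → ℝ}
    (hst : IsArchStablyConjH L (endoTorus L S c) (endoTorus L S' c')) (w : {w : InfinitePlace L // IsComplex w}) :
    IsConj ((endoBlock L S c w : ↥(archLocal L 2 (Matrix.of fun i j : Fin 2 => if i.val + j.val + 1 = 2 then (1 : L) else 0) w)) : GL (Fin 2) ℂ)
      ((endoBlock L S' c' w : ↥(archLocal L 2 (Matrix.of fun i j : Fin 2 => if i.val + j.val + 1 = 2 then (1 : L) else 0) w)) : GL (Fin 2) ℂ) := by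
  have h := hst.1
  rw [isStablyConj_arch_iff_forall_place] at h
  have hw := h w
  rw [archPiEquivCM_endoTorus_fst, archPiEquivCM_endoTorus_fst] at hw
  exact hw

/-- Place projection of a stable conjugacy between chart points: the `U(Φ₁)_w`-components AGREE (`GL₁(ℂ)` is commutative). [cite: Rogawski1990, §4.9 p. 54] -/
theorem endoCircle_eq_of_isArchStablyConjH {S S' : Finset {w : InfinitePlace L // IsComplex w}} {c c' : {w : InfinitePlace L // IsComplex w} → Fin 3 → ℝ}
    (hst : IsArchStablyConjH L (endoTorus L S c) (endoTorus L S' c')) (w : {w : InfinitePlace L // IsComplex w}) :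
    endoCircle L c' w = endoCircle L c w := by
  have h := hst.2
  rw [isStablyConj_arch_iff_forall_place] at h
  have hw := h w
  rw [archPiEquivCM_endoTorus_snd, archPiEquivCM_endoTorus_snd] at hw
  exact (Subtype.ext (eq_of_isConj_GL_one hw)).symm

variable (S : Finset {w : InfinitePlace L // IsComplex w})

/-- **THE CARTAN TYPE IS A STABLE INVARIANT**: `endoTorus S c ∼_st endoTorus S′ c′` with `c ∈ RegG S`, `c′ ∈ RegG S′` forces `S′ = S` (a place is split for `γ` iff the
`2`-block has a non-unit eigenvalue, i.e. `‖tr‖ > 2`). [cite: Rogawski1990, §3.6 p. 31; §4.1 p. 39] [cite: Shelstad1979, §4 p. 22] -/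
theorem eq_of_isArchStablyConjH_endoTorus (S' : Finset {w : InfinitePlace L // IsComplex w}) {c c' : {w : InfinitePlace L // IsComplex w} → Fin 3 → ℝ}
    (hc : c ∈ ArchCartan.RegG S) (hc' : c' ∈ ArchCartan.RegG S') (hst : IsArchStablyConjH L (endoTorus L S c) (endoTorus L S' c')) : S' = S := by
  ext w
  have h := isConj_coe_endoBlock_of_isArchStablyConjH L hst w
  constructor
  · intro hw'
    by_contra hw
    rw [coe_endoBlock_eq_cayley_of_not_mem L S _ hw, coe_endoBlock_eq_hypBlockGL_of_mem L S' _ hw'] at h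
    exact not_isConj_cayley_hypBlockGL _ _ _ (hc'.2 w hw') h
  · intro hw
    by_contra hw'
    rw [coe_endoBlock_eq_hypBlockGL_of_mem L S _ hw, coe_endoBlock_eq_cayley_of_not_mem L S' _ hw'] at h
    exact not_isConj_cayley_hypBlockGL _ _ _ (hc.2 w hw) h.symm

/-- **UNIQUENESS OF CHART COORDINATES UP TO FLIPS**: if `endoTorus S c ∼_st endoTorus S c′` (`c, c′ ∈ RegG S`) then `endoTorus S c′` is `H_∞`-CONJUGATE to a flip
`endoTorus S (flipSet T c)`, `T ⊆ univ ∖ S` — at `w ∉ S` the angle pair agrees up to `θ₀ ↔ θ₂` (defining `T`), at `w ∈ S` the angle class agrees and `x′ = ±x`, the sign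
realised by the swap `J ∈ U(Φ₂)_w` (★ `swapGL_conj_hypBlockGL`); the `U(Φ₁)`-components agree; glued with ★ `archPiEquivCM`.
[cite: Rogawski1990, §3.6 p. 31; §4.1 p. 39; §8.2 p. 122] [cite: Shelstad1979, §4 pp. 22–23] -/
theorem exists_conj_eq_endoTorus_flipSet_of_isArchStablyConjH {c c' : {w : InfinitePlace L // IsComplex w} → Fin 3 → ℝ}
    (hc : c ∈ ArchCartan.RegG S) (hst : IsArchStablyConjH L (endoTorus L S c) (endoTorus L S c')) :
    ∃ T ∈ (Finset.univ \ S).powerset, ∃ n : (↥(arch (↥(maximalRealSubfield L)) L (IsCMField.complexConj L) 2 (Matrix.of fun i j : Fin 2 => if i.val + j.val + 1 = 2 then (1 : L) else 0)) ×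
        ↥(arch (↥(maximalRealSubfield L)) L (IsCMField.complexConj L) 1 (Matrix.of fun i j : Fin 1 => if i.val + j.val + 1 = 1 then (1 : L) else 0))),
      n * endoTorus L S c' * n⁻¹ = endoTorus L S (flipSet T c) := by
  -- the flipped places
  set T : Finset {w : InfinitePlace L // IsComplex w} :=
    (Finset.univ \ S).filter fun w => Circle.exp (c' w 0) = Circle.exp (c w 2) ∧ Circle.exp (c' w 2) = Circle.exp (c w 0) with hT
  have hTS : T ∈ (Finset.univ \ S).powerset := Finset.mem_powerset.2 (Finset.filter_subset _ _)
  -- per-place conjugators in `U(Φ₂)_w`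
  have key : ∀ w : {w : InfinitePlace L // IsComplex w}, ∃ k : ↥(archLocal L 2 (Matrix.of fun i j : Fin 2 => if i.val + j.val + 1 = 2 then (1 : L) else 0) w),
      (k : GL (Fin 2) ℂ) * (endoBlock L S c' w : GL (Fin 2) ℂ) * (k : GL (Fin 2) ℂ)⁻¹ = (endoBlock L S (flipSet T c) w : GL (Fin 2) ℂ) := by
    intro w
    have h := isConj_coe_endoBlock_of_isArchStablyConjH L hst w
    by_cases hw : w ∈ S
    · -- split place: same angle class, `x′ = ±x`
      rw [coe_endoBlock_eq_hypBlockGL_of_mem L S _ hw, coe_endoBlock_eq_hypBlockGL_of_mem L S _ hw] at h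
      obtain ⟨hθ, hx⟩ := circleExp_eq_and_eq_or_eq_neg_of_isConj_hypBlockGL h
      have hwT : w ∉ T := fun hwT => (Finset.mem_sdiff.1 (Finset.mem_filter.1 hwT).1).2 hw
      rcases hx with hx | hx
      · refine ⟨1, ?_⟩
        rw [OneMemClass.coe_one, one_mul, inv_one, mul_one, coe_endoBlock_eq_hypBlockGL_of_mem L S _ hw, coe_endoBlock_eq_hypBlockGL_of_mem L S _ hw,
          flipSet_apply_of_not_mem hwT, ← hx]
        exact hypBlockGL_eq_of_circleExp_eq _ hθ.symm
      · refine ⟨⟨Matrix.GeneralLinearGroup.mkOfDetNeZero !![(0 : ℂ), 1; 1, 0] det_swapTwo_ne_zero, swapGL_mem_archLocal L w⟩, ?_⟩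
        rw [coe_endoBlock_eq_hypBlockGL_of_mem L S _ hw, coe_endoBlock_eq_hypBlockGL_of_mem L S _ hw, flipSet_apply_of_not_mem hwT, swapGL_conj_hypBlockGL,
          show -c' w 0 = c w 0 by rw [hx]]
        exact hypBlockGL_eq_of_circleExp_eq _ hθ.symm
    · -- compact place: same or flipped angle pair
      rw [coe_endoBlock_eq_cayley_of_not_mem L S _ hw, coe_endoBlock_eq_cayley_of_not_mem L S _ hw] at h
      rcases eq_or_swap_of_isConj_cayley h with ⟨h0, h2⟩ | ⟨h0, h2⟩
      · have hwT : w ∉ T := by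
          intro hwT
          have hfl := (Finset.mem_filter.1 hwT).2
          exact (regG_subset_regS S hc).1 w hw (h0.trans hfl.1)
        refine ⟨1, ?_⟩
        rw [OneMemClass.coe_one, one_mul, inv_one, mul_one, coe_endoBlock_eq_cayley_of_not_mem L S _ hw, coe_endoBlock_eq_cayley_of_not_mem L S _ hw,
          flipSet_apply_of_not_mem hwT, h0, h2]
      · have hwT : w ∈ T := Finset.mem_filter.2 ⟨Finset.mem_sdiff.2 ⟨Finset.mem_univ _, hw⟩, h2.symm, h0.symm⟩
        refine ⟨1, ?_⟩
        rw [OneMemClass.coe_one, one_mul, inv_one, mul_one, coe_endoBlock_eq_cayley_of_not_mem L S _ hw, coe_endoBlock_eq_cayley_of_not_mem L S _ hw,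
          flipSet_apply_of_mem hwT, ← h0, ← h2]
        rfl
  choose k hk using key
  refine ⟨T, hTS, (((archPiEquivCM 2 L (Matrix.of fun i j : Fin 2 => if i.val + j.val + 1 = 2 then (1 : L) else 0)).symm k, 1) :
    (↥(arch (↥(maximalRealSubfield L)) L (IsCMField.complexConj L) 2 (Matrix.of fun i j : Fin 2 => if i.val + j.val + 1 = 2 then (1 : L) else 0)) ×
      ↥(arch (↥(maximalRealSubfield L)) L (IsCMField.complexConj L) 1 (Matrix.of fun i j : Fin 1 => if i.val + j.val + 1 = 1 then (1 : L) else 0)))), ?_⟩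
  refine Prod.ext ?_ ?_
  · apply (archPiEquivCM 2 L (Matrix.of fun i j : Fin 2 => if i.val + j.val + 1 = 2 then (1 : L) else 0)).injective
    rw [Prod.fst_mul, Prod.fst_mul, Prod.fst_inv, map_mul, map_mul, map_inv, ContinuousMulEquiv.apply_symm_apply]
    funext w
    rw [Pi.mul_apply, Pi.mul_apply, Pi.inv_apply, archPiEquivCM_endoTorus_fst, archPiEquivCM_endoTorus_fst]
    apply Subtype.ext
    rw [Subgroup.coe_mul, Subgroup.coe_mul, Subgroup.coe_inv]
    exact hk w
  · apply (archPiEquivCM 1 L (Matrix.of fun i j : Fin 1 => if i.val + j.val + 1 = 1 then (1 : L) else 0)).injective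
    rw [Prod.snd_mul, Prod.snd_mul, Prod.snd_inv, inv_one, one_mul, mul_one]
    funext w
    rw [archPiEquivCM_endoTorus_snd, archPiEquivCM_endoTorus_snd, endoCircle_eq_of_isArchStablyConjH L hst w, endoCircle_flipSet]

end Unique

/-! ## §4 The stable class of a `G`-regular chart point is its set of flip classes -/

section Classes

variable (L : Type) [Field L] [NumberField L] [IsCMField L] (S : Finset {w : InfinitePlace L // IsComplex w})

/-- **EVERY CLASS IN THE STABLE CLASS OF `endoTorus S c` (`c ∈ RegG S`) IS A FLIP CLASS** (★ (EXH-H) puts a representative in chart form `h·endoTorus S′ c′·h⁻¹`;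
`S′ = S` and the coordinates are a flip of `c` up to `H_∞`-conjugacy by §3). [cite: Rogawski1990, §4.1 p. 39] [cite: Shelstad1979, §4 pp. 22–23] -/
theorem exists_flipSet_mk_eq_of_isArchStablyConjH_out {c : {w : InfinitePlace L // IsComplex w} → Fin 3 → ℝ} (hc : c ∈ ArchCartan.RegG S)
    (c₁ : ConjClasses (↥(arch (↥(maximalRealSubfield L)) L (IsCMField.complexConj L) 2 (Matrix.of fun i j : Fin 2 => if i.val + j.val + 1 = 2 then (1 : L) else 0)) ×
      ↥(arch (↥(maximalRealSubfield L)) L (IsCMField.complexConj L) 1 (Matrix.of fun i j : Fin 1 => if i.val + j.val + 1 = 1 then (1 : L) else 0))))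
    (h : IsArchStablyConjH L (endoTorus L S c) (Quotient.out c₁)) :
    ∃ T ∈ (Finset.univ \ S).powerset, c₁ = ConjClasses.mk (endoTorus L S (flipSet T c)) := by
  -- the representative is `G`-regular, hence in chart form
  have hreg : IsArchGRegular L (Quotient.out c₁) := isGRegular_of_isStablyConjH _ _ _ _ h ((isArchGRegular_endoTorus_iff_mem_regG L S c).2 hc)
  obtain ⟨S', c', g, hc', hγ⟩ := exists_conj_endoTorus_of_isArchGRegular L _ hreg
  have hconj : IsConj (endoTorus L S' c') (Quotient.out c₁) := isConj_iff.2 ⟨g, hγ.symm⟩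
  have hst : IsArchStablyConjH L (endoTorus L S c) (endoTorus L S' c') := h.trans (isStablyConjH_of_isConj hconj.symm)
  have hSS : S' = S := eq_of_isArchStablyConjH_endoTorus L S S' hc hc' hst
  subst hSS
  obtain ⟨T, hT, n, hn⟩ := exists_conj_eq_endoTorus_flipSet_of_isArchStablyConjH L S' hc hst
  refine ⟨T, hT, ?_⟩
  have hc₁ : ConjClasses.mk (Quotient.out c₁) = c₁ := Quotient.out_eq c₁
  rw [← hc₁, ConjClasses.mk_eq_mk_iff_isConj]
  exact hconj.symm.trans (isConj_iff.2 ⟨n, hn⟩)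

/-- **THE `hidx` OF R4 (READ-H), VERBATIM**: for `c ∈ RegG S` the classes of `H_∞` inside the stable class of `endoTorus S c` are exactly the `2^{|univ ∖ S|}` flip classes
`⟦endoTorus S (flipSet T c)⟧`, `T ⊆ univ ∖ S` («⊇» ★ p849928 `isArchStablyConjH_out_mk_endoTorus_flipSet`; «⊆» `exists_flipSet_mk_eq_of_isArchStablyConjH_out`; they are
pairwise distinct by ★ p849928 `injOn_conjClassesMk_endoTorus_flipSet`). [cite: Rogawski1990, §4.1 p. 39] [cite: Shelstad1979, §4 pp. 22–23] -/
theorem setOf_isArchStablyConjH_out_eq_image_flipSet {c : {w : InfinitePlace L // IsComplex w} → Fin 3 → ℝ} (hc : c ∈ ArchCartan.RegG S) :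
    {c' : ConjClasses (↥(arch (↥(maximalRealSubfield L)) L (IsCMField.complexConj L) 2 (Matrix.of fun i j : Fin 2 => if i.val + j.val + 1 = 2 then (1 : L) else 0)) ×
        ↥(arch (↥(maximalRealSubfield L)) L (IsCMField.complexConj L) 1 (Matrix.of fun i j : Fin 1 => if i.val + j.val + 1 = 1 then (1 : L) else 0))) |
        IsArchStablyConjH L (endoTorus L S c) (Quotient.out c')} =
      (fun T : Finset {w : InfinitePlace L // IsComplex w} => ConjClasses.mk (endoTorus L S (flipSet T c))) '' ↑((Finset.univ \ S).powerset) := by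
  ext c₁
  constructor
  · intro h
    obtain ⟨T, hT, h1⟩ := exists_flipSet_mk_eq_of_isArchStablyConjH_out L S hc c₁ h
    exact ⟨T, Finset.mem_coe.2 hT, h1.symm⟩
  · rintro ⟨T, hT, rfl⟩
    exact isArchStablyConjH_out_mk_endoTorus_flipSet L S (not_mem_of_mem_powerset_sdiff (Finset.mem_coe.1 hT)) c

end Classes

end Literature.NumberTheory.Automorphic.UnitaryGroup

end
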